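import Summits.QuantumFields.YangMills.Theorems.BalabanUVNodesN21CollarOddsBlockFrame

/-!
# N21 (NE7c) · THE OUTER SHELLS OF A COLLAR LETTER: conditional odds of a two-sided SUB-level letter's relaxation,
# hazard pointing INWARD on both sides (lens v28.0 ROW R — the ONE adapter, on `ι → ℝ` and in the block frame)

R141 (C) seat pub-ymgap-dag-n21-e (g15), node N21 = NE7c (single-run shell-weight bound, NOT PRINTED in [Bałaban
1983–89], NOT proved), strategy s3 ALTERNATIVE CURRENCY, lane K3⁷ `SpineGivenEndpointR13SepCoPH`
(stmt-QuantumFields-20544, `--kind proof --supports … --as helper`).  Part 38k of this seat's series (successor of 38i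
`…N21CollarOddsProduct` p569648 and 38j `…N21CollarOddsBlockFrame`).  THE MATHEMATICS OF THE ROW is the lens's
(`ym-lens-BalabanUVNodes-nearmiss` v28.0 Card 83 ∕ ROW R, first refusal to this seat, l.23365 ∕ l.23371).

WHY (lens v28.0, state W²⁶, Card 83 «KEPT LETTERS SPLIT BY SUPPORT»).  On the re-centred dilation road (n21-d parts
27∕28; P2 `…N21RecentredDilationTransversal.slotAntiConcentration_restrict_of_recentredDilation`) the centre `m z`
need not satisfy a KEPT collar letter `{|w_b| < θₑ}`: under `w ↦ m + l(w − m)`, `l ∈ [l₀, 1]`, `|m_b| ≤ M`, the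
letter maps into the RELAXED letter `{|w_b| < θₑ′}` (lens `collarImage_mem_relaxedLetter` = P2's `henv` letter by
letter), so P2's envelope exceeds the support by the OUTER shells `{θₑ ≤ |w_b| < θₑ′}`, paid in P2's one odds
binder `hQ`.  38i ∕ 38j price the LEFT shell of a dropped `≥`-cut (hazard pointing outward); the outer shells of a
sub-level letter need the MIRRORED device (shell ABOVE the reference, the weight `e^{−A}` not dropping INWARD) and
its REFLECTION — typed natively: a window hypothesis `Λ⁻¹ < 2θₑ` keeps every comparison window inside letter ∪ shell.
* §1 (ℝ) `setLIntegral_le_of_nonCollapse_window` — part 8 §1 with an arbitrary window offset `r`;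
* §2 (ℝ, `e^{−W}`) `lintegral_upperShell_le_of_inwardSlope` ∕ `lintegral_lowerShell_le_of_inwardSlope`;
* §3 (`ι → ℝ`, `vol.withDensity e^{−A}`: G21's ∕ 38i §2's frame, the lens's requested shape) the two conditioned
  shell hazards (part 9 `measure_coordSlice_le_of_fibrewise` BY NAME), `measure_le_odds_of_rel`
  (`T4MarginalRenewal.odds_of_rel` BY NAME), `condOdds_letter_of_shellHazards` and
  ★ `condOdds_absCoord_of_partialSlopes`: `ν({θ ≤ |x_p| < θ′} ∩ C) ≤ 2c∕(1−c) · ν({|x_p| < θ} ∩ C)`, `c = e·Λ·(θ′−θ)`;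
* §4 (block frame `X × (κ → ℝ)`, `(ζ ⊗ vol).withDensity e^{−A}`; §3 on every exterior fibre + 38j §1
  `measure_le_mul_of_fibrewise` BY NAME) ★ `condOdds_absBlockCoord_of_partialSlopes` — the per-letter `hodds` input
  of 38i §1's product in P2's frame, on `({p.2 i ∈ (−θ′,θ′)} ∖ {p.2 i ∈ (−θ,θ)}) ∩ C` (`setOf_mem_Ioo_eq_abs_lt`);
* §5 A6 witness (director-ym STANDING A6 RULE №189 (3)): Gaussian block weight over the one-point exterior, letter
  `{|w₀| < 1}` relaxed to `{|w₀| < 7∕6}`, `Λ = 2`: `gaussianBlock_update_diff`, `gaussianBlock_inwardSlopes`,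
  ★ `collarLetterOdds_binders_inhabited` — §4's END with every binder discharged in the kernel.

HONEST FRAMING.  [textbook] measure theory (windowed hazard ∕ Tonelli) + real arithmetic; 0 def, 0 sorry; slopes,
thresholds and the not-read structure are HYPOTHESES (NODE O's term object ∕ n21-d's hazard numbers; the lens's Card
83 (k1) letter is NOT asserted); nothing of Bałaban's asserted ([Balaban1989LargeFieldI] p. 176 ∕ p. 193 = the
located MECHANISM only); NE7c NOT PRINTED ∕ NOT proved; N21 NOT discharged; counts unmoved (typed 28∕28 ·
discharged 5∕27); count-neutral; one finite 𝕋⁴ at fixed ε — nothing about ℝ⁴ ∕ OS ∕ mass gap ∕ Clay.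
-/

set_option autoImplicit false

open MeasureTheory Set Function
open scoped ENNReal

namespace Summit.QuantumFields.YangMills.Theorems.N21CollarLetterOdds

open Literature.MathematicalPhysics.QuantumFieldTheory.Balaban1983to89.T4MarginalRenewal (odds_of_rel)
open Summit.QuantumFields.YangMills.Theorems.N21GibbsBlockSupHazard (measure_coordSlice_le_of_fibrewise)
open Summit.QuantumFields.YangMills.Theorems.N21CollarOddsBlockFrame (measure_le_mul_of_fibrewise)

/-! ## §1 The windowed hazard with an arbitrary window offset -/

/-- **LOCAL NON-COLLAPSE TOWARD A WINDOW ⇒ HAZARD** (part 8 §1 with the window displaced by `r`): `f(x) ≤ M·f(y)` for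
`x ∈ S`, `y ∈ [x + r, x + r + δ]` (`δ > 0`), and every such window inside `T` ⇒ `∫_S f ≤ M·δ⁻¹·|S| · ∫_T f`
(Lebesgue measure; `r = 0`: hazard pointing right, part 8; `r = −δ`: pointing left). [textbook] -/
theorem setLIntegral_le_of_nonCollapse_window {f : ℝ → ℝ≥0∞} (hf : Measurable f) {S T : Set ℝ}
    (hS : MeasurableSet S) {r δ : ℝ} (hδ : 0 < δ) (M : ℝ≥0∞)
    (h : ∀ x ∈ S, ∀ y ∈ Icc (x + r) (x + r + δ), f x ≤ M * f y)
    (hT : ∀ x ∈ S, Icc (x + r) (x + r + δ) ⊆ T) :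
    ∫⁻ x in S, f x ≤ M * (ENNReal.ofReal δ)⁻¹ * volume S * ∫⁻ y in T, f y := by
  set I := ∫⁻ y in T, f y with hI
  have hδ0 : ENNReal.ofReal δ ≠ 0 := (ENNReal.ofReal_pos.2 hδ).ne'
  have hδtop : ENNReal.ofReal δ ≠ ⊤ := ENNReal.ofReal_ne_top
  -- pointwise: `δ · f(x) ≤ M · I`
  have hpt : ∀ x ∈ S, f x ≤ (ENNReal.ofReal δ)⁻¹ * (M * I) := by
    intro x hx
    have h1 : ENNReal.ofReal δ * f x ≤ M * I := by
      calc ENNReal.ofReal δ * f x = ∫⁻ _ in Icc (x + r) (x + r + δ), f x := by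
            rw [setLIntegral_const, Real.volume_Icc, mul_comm]
            congr 2
            ring
        _ ≤ ∫⁻ y in Icc (x + r) (x + r + δ), M * f y :=
            setLIntegral_mono' measurableSet_Icc fun y hy => h x hx y hy
        _ = M * ∫⁻ y in Icc (x + r) (x + r + δ), f y := lintegral_const_mul M hf
        _ ≤ M * I := mul_le_mul_right (lintegral_mono_set (hT x hx)) _
    calc f x = (ENNReal.ofReal δ)⁻¹ * (ENNReal.ofReal δ * f x) := by
          rw [← mul_assoc, ENNReal.inv_mul_cancel hδ0 hδtop, one_mul]
      _ ≤ (ENNReal.ofReal δ)⁻¹ * (M * I) := mul_le_mul_right h1 _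
  calc ∫⁻ x in S, f x ≤ ∫⁻ _ in S, (ENNReal.ofReal δ)⁻¹ * (M * I) := setLIntegral_mono' hS hpt
    _ = (ENNReal.ofReal δ)⁻¹ * (M * I) * volume S := by rw [setLIntegral_const]
    _ = M * (ENNReal.ofReal δ)⁻¹ * volume S * I := by ring

/-! ## §2 The two outer shells of a letter `{|y| < θ}` under inward one-sided slope bounds -/

/-- constants: `e · (Λ⁻¹)⁻¹ · (θ′ − θ) = e·Λ·(θ′ − θ)` in `ℝ≥0∞`. -/
theorem shellConst_eq {Λ θ θ' : ℝ} (hΛ : 0 < Λ) :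
    ENNReal.ofReal (Real.exp 1) * (ENNReal.ofReal Λ⁻¹)⁻¹ * ENNReal.ofReal (θ' - θ)
      = ENNReal.ofReal (Real.exp 1 * Λ * (θ' - θ)) := by
  rw [ENNReal.ofReal_inv_of_pos hΛ, inv_inv, ← ENNReal.ofReal_mul (Real.exp_pos 1).le,
    ← ENNReal.ofReal_mul (mul_pos (Real.exp_pos 1) hΛ).le]

/-- **UPPER OUTER SHELL, HAZARD POINTING INWARD.**  Density `e^{−W}`, `W` measurable; on the shell `[θ, θ′)` the
action increases by at most `Λ` per unit going LEFT within `Λ⁻¹` (the weight does not drop inward), and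
`Λ⁻¹ < 2θ` (windows stay inside `(−θ, θ′)`): `∫_{[θ,θ′)} e^{−W} ≤ e·Λ·(θ′−θ) · ∫_{(−θ,θ′)} e^{−W}`. [textbook] -/
theorem lintegral_upperShell_le_of_inwardSlope {W : ℝ → ℝ} (hWm : Measurable W) {θ θ' Λ : ℝ} (hΛ : 0 < Λ)
    (hwin : Λ⁻¹ < 2 * θ)
    (hW : ∀ y₁ ∈ Ico θ θ', ∀ y₂ ∈ Icc (y₁ - Λ⁻¹) y₁, W y₂ - W y₁ ≤ Λ * (y₁ - y₂)) :
    ∫⁻ y in Ico θ θ', ENNReal.ofReal (Real.exp (-W y))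
      ≤ ENNReal.ofReal (Real.exp 1 * Λ * (θ' - θ)) * ∫⁻ y in Ioo (-θ) θ', ENNReal.ofReal (Real.exp (-W y)) := by
  have hf : Measurable fun y => ENNReal.ofReal (Real.exp (-W y)) :=
    ENNReal.measurable_ofReal.comp (Real.measurable_exp.comp hWm.neg)
  have h := setLIntegral_le_of_nonCollapse_window hf (S := Ico θ θ') (T := Ioo (-θ) θ') measurableSet_Ico
    (r := -Λ⁻¹) (inv_pos.2 hΛ) (ENNReal.ofReal (Real.exp 1)) ?_ ?_
  · rwa [Real.volume_Ico, shellConst_eq hΛ] at h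
  · intro y₁ hy₁ y₂ hy₂
    have hy₂' : y₂ ∈ Icc (y₁ - Λ⁻¹) y₁ := ⟨by linarith [hy₂.1], by linarith [hy₂.2]⟩
    have h1 := hW y₁ hy₁ y₂ hy₂'
    have h2 : Λ * (y₁ - y₂) ≤ Λ * Λ⁻¹ := mul_le_mul_of_nonneg_left (by linarith [hy₂'.1]) hΛ.le
    rw [mul_inv_cancel₀ hΛ.ne'] at h2
    rw [← ENNReal.ofReal_mul (Real.exp_pos 1).le, ← Real.exp_add]
    exact ENNReal.ofReal_le_ofReal (Real.exp_le_exp.2 (by linarith))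
  · intro y₁ hy₁ y hy
    exact ⟨by linarith [hy.1, hy₁.1], by linarith [hy.2, hy₁.2]⟩

/-- **LOWER OUTER SHELL, HAZARD POINTING INWARD.**  On the shell `(−θ′, −θ]` the action increases by at most `Λ` per
unit going RIGHT within `Λ⁻¹`, and `Λ⁻¹ < 2θ`: `∫_{(−θ′,−θ]} e^{−W} ≤ e·Λ·(θ′−θ) · ∫_{(−θ′,θ)} e^{−W}`. [textbook] -/
theorem lintegral_lowerShell_le_of_inwardSlope {W : ℝ → ℝ} (hWm : Measurable W) {θ θ' Λ : ℝ} (hΛ : 0 < Λ)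
    (hwin : Λ⁻¹ < 2 * θ)
    (hW : ∀ y₁ ∈ Ioc (-θ') (-θ), ∀ y₂ ∈ Icc y₁ (y₁ + Λ⁻¹), W y₂ - W y₁ ≤ Λ * (y₂ - y₁)) :
    ∫⁻ y in Ioc (-θ') (-θ), ENNReal.ofReal (Real.exp (-W y))
      ≤ ENNReal.ofReal (Real.exp 1 * Λ * (θ' - θ)) * ∫⁻ y in Ioo (-θ') θ, ENNReal.ofReal (Real.exp (-W y)) := by
  have hf : Measurable fun y => ENNReal.ofReal (Real.exp (-W y)) :=
    ENNReal.measurable_ofReal.comp (Real.measurable_exp.comp hWm.neg)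
  have h := setLIntegral_le_of_nonCollapse_window hf (S := Ioc (-θ') (-θ)) (T := Ioo (-θ') θ)
    measurableSet_Ioc (r := 0) (inv_pos.2 hΛ) (ENNReal.ofReal (Real.exp 1)) ?_ ?_
  · rw [Real.volume_Ioc, show -θ - -θ' = θ' - θ by ring, shellConst_eq hΛ] at h
    exact h
  · intro y₁ hy₁ y₂ hy₂
    have hy₂' : y₂ ∈ Icc y₁ (y₁ + Λ⁻¹) := ⟨by linarith [hy₂.1], by linarith [hy₂.2]⟩
    have h1 := hW y₁ hy₁ y₂ hy₂'
    have h2 : Λ * (y₂ - y₁) ≤ Λ * Λ⁻¹ := mul_le_mul_of_nonneg_left (by linarith [hy₂'.2]) hΛ.le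
    rw [mul_inv_cancel₀ hΛ.ne'] at h2
    rw [← ENNReal.ofReal_mul (Real.exp_pos 1).le, ← Real.exp_add]
    exact ENNReal.ofReal_le_ofReal (Real.exp_le_exp.2 (by linarith))
  · intro y₁ hy₁ y hy
    exact ⟨by linarith [hy.1, hy₁.1], by linarith [hy.2, hy₁.2]⟩

/-! ## §3 Coordinate version on `ℝ^ι` (G21's ∕ 38i §2's frame): the lens's requested adapter -/

section Coord

variable {ι : Type*} [Fintype ι] [DecidableEq ι]

/-- **UPPER OUTER SHELL OF A COORDINATE LETTER, CONDITIONED.**  `ν = e^{−A} dx` on `ℝ^ι`, `A` measurable, the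
inward slope bound along `x_p` on `[θ, θ′)` uniformly in the other coordinates, `Λ⁻¹ < 2θ`, `C` measurable with
`(x with x_p := y) ∈ C ↔ x ∈ C`: `ν({θ ≤ x_p < θ′} ∩ C) ≤ e·Λ·(θ′−θ) · ν({−θ < x_p < θ′} ∩ C)` (part 9
`measure_coordSlice_le_of_fibrewise` + §2 on every fibre). [textbook] -/
theorem measure_coordUpperShell_le_of_inwardSlope {A : (ι → ℝ) → ℝ} (hA : Measurable A) (p : ι)
    {θ θ' Λ : ℝ} (hΛ : 0 < Λ) (hwin : Λ⁻¹ < 2 * θ)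
    (hup : ∀ x : ι → ℝ, ∀ y₁ ∈ Ico θ θ', ∀ y₂ ∈ Icc (y₁ - Λ⁻¹) y₁,
      A (update x p y₂) - A (update x p y₁) ≤ Λ * (y₁ - y₂))
    {C : Set (ι → ℝ)} (hC : MeasurableSet C) (hCp : ∀ x y, update x p y ∈ C ↔ x ∈ C) :
    (volume.withDensity fun x : ι → ℝ => ENNReal.ofReal (Real.exp (-A x))) ({x | x p ∈ Ico θ θ'} ∩ C)
      ≤ ENNReal.ofReal (Real.exp 1 * Λ * (θ' - θ)) *
        (volume.withDensity fun x : ι → ℝ => ENNReal.ofReal (Real.exp (-A x))) ({x | x p ∈ Ioo (-θ) θ'} ∩ C) := by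
  have hg : Measurable fun x : ι → ℝ => ENNReal.ofReal (Real.exp (-A x)) :=
    ENNReal.measurable_ofReal.comp (Real.measurable_exp.comp hA.neg)
  refine measure_coordSlice_le_of_fibrewise hg p measurableSet_Ico measurableSet_Ioo _ ENNReal.ofReal_ne_top
    (fun x => ?_) hC hCp
  have hW : Measurable fun y => A (update x p y) := hA.comp (measurable_update x)
  have h := lintegral_upperShell_le_of_inwardSlope hW hΛ hwin (fun y₁ hy₁ y₂ hy₂ => hup x y₁ hy₁ y₂ hy₂)
  exact h

/-- **LOWER OUTER SHELL OF A COORDINATE LETTER, CONDITIONED**: `ν({−θ′ < x_p ≤ −θ} ∩ C) ≤ e·Λ·(θ′−θ) ·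
ν({−θ′ < x_p < θ} ∩ C)` under the inward (rightward) slope bound on `(−θ′, −θ]`. [textbook] -/
theorem measure_coordLowerShell_le_of_inwardSlope {A : (ι → ℝ) → ℝ} (hA : Measurable A) (p : ι)
    {θ θ' Λ : ℝ} (hΛ : 0 < Λ) (hwin : Λ⁻¹ < 2 * θ)
    (hlow : ∀ x : ι → ℝ, ∀ y₁ ∈ Ioc (-θ') (-θ), ∀ y₂ ∈ Icc y₁ (y₁ + Λ⁻¹),
      A (update x p y₂) - A (update x p y₁) ≤ Λ * (y₂ - y₁))
    {C : Set (ι → ℝ)} (hC : MeasurableSet C) (hCp : ∀ x y, update x p y ∈ C ↔ x ∈ C) :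
    (volume.withDensity fun x : ι → ℝ => ENNReal.ofReal (Real.exp (-A x))) ({x | x p ∈ Ioc (-θ') (-θ)} ∩ C)
      ≤ ENNReal.ofReal (Real.exp 1 * Λ * (θ' - θ)) *
        (volume.withDensity fun x : ι → ℝ => ENNReal.ofReal (Real.exp (-A x))) ({x | x p ∈ Ioo (-θ') θ} ∩ C) := by
  have hg : Measurable fun x : ι → ℝ => ENNReal.ofReal (Real.exp (-A x)) :=
    ENNReal.measurable_ofReal.comp (Real.measurable_exp.comp hA.neg)
  refine measure_coordSlice_le_of_fibrewise hg p measurableSet_Ioc measurableSet_Ioo _ ENNReal.ofReal_ne_top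
    (fun x => ?_) hC hCp
  have hW : Measurable fun y => A (update x p y) := hA.comp (measurable_update x)
  have h := lintegral_lowerShell_le_of_inwardSlope hW hΛ hwin (fun y₁ hy₁ y₂ hy₂ => hlow x y₁ hy₁ y₂ hy₂)
  exact h

end Coord

/-- **RELATIVE ⇒ ODDS IN `ℝ≥0∞`.**  For a finite measure: `ν S ≤ c · ν T` with `T ⊆ S ∪ P`, `0 ≤ c < 1` ⇒
`ν S ≤ c∕(1−c) · ν P` (`T4MarginalRenewal.odds_of_rel` BY NAME; G21 §1 is the instance
`S = {a ≤ u < b}`, `T = {a ≤ u}`, `P = {b ≤ u}`). [textbook] -/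
theorem measure_le_odds_of_rel {Ω : Type*} [MeasurableSpace Ω] (ν : Measure Ω) [IsFiniteMeasure ν]
    {S T P : Set Ω} {c : ℝ} (hc0 : 0 ≤ c) (hc1 : c < 1) (hT : T ⊆ S ∪ P)
    (h : ν S ≤ ENNReal.ofReal c * ν T) : ν S ≤ ENNReal.ofReal (c / (1 - c)) * ν P := by
  have h1 : ν.real S ≤ c * (ν.real S + ν.real P) := by
    have h' := ENNReal.toReal_mono (ENNReal.mul_ne_top ENNReal.ofReal_ne_top (measure_ne_top ν _)) h
    rw [ENNReal.toReal_mul, ENNReal.toReal_ofReal hc0] at h'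
    refine (le_of_eq (measureReal_def ν _)).trans (h'.trans (mul_le_mul_of_nonneg_left ?_ hc0))
    rw [← measureReal_def]
    exact (measureReal_mono hT).trans (measureReal_union_le _ _)
  have hr := odds_of_rel hc1 h1
  have hc' : 0 ≤ c / (1 - c) := div_nonneg hc0 (by linarith)
  rw [← ofReal_measureReal (μ := ν) (s := S), ← ofReal_measureReal (μ := ν) (s := P), ← ENNReal.ofReal_mul hc']
  exact ENNReal.ofReal_le_ofReal hr

/-- set bookkeeping for a two-sided letter: the outer shells, the letter, and the comparison windows. -/
theorem letter_sets {Ω : Type*} (u : Ω → ℝ) (θ θ' : ℝ) :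
    ({x | u x ∈ Ioo (-θ') θ'} \ {x | u x ∈ Ioo (-θ) θ}
        ⊆ {x | u x ∈ Ico θ θ'} ∪ {x | u x ∈ Ioc (-θ') (-θ)}) ∧
      ({x | u x ∈ Ioo (-θ) θ'} ⊆ {x | u x ∈ Ico θ θ'} ∪ {x | u x ∈ Ioo (-θ) θ}) ∧
      ({x | u x ∈ Ioo (-θ') θ} ⊆ {x | u x ∈ Ioc (-θ') (-θ)} ∪ {x | u x ∈ Ioo (-θ) θ}) := by
  simp only [subset_def, mem_sdiff, mem_union, mem_setOf_eq, mem_Ioo, mem_Ico, mem_Ioc, not_and, not_lt]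
  refine ⟨fun x hx => ?_, fun x hx => ?_, fun x hx => ?_⟩
  · rcases lt_or_ge (u x) θ with h | h
    · exact Or.inr ⟨hx.1.1, by by_contra hc; exact absurd (hx.2 (lt_of_not_ge hc)) (not_le.2 h)⟩
    · exact Or.inl ⟨h, hx.1.2⟩
  · rcases lt_or_ge (u x) θ with h | h
    exacts [Or.inr ⟨hx.1, h⟩, Or.inl ⟨h, hx.2⟩]
  · rcases le_or_gt (u x) (-θ) with h | h
    exacts [Or.inl ⟨hx.1, h⟩, Or.inr ⟨h, hx.2⟩]

/-- the letter and its relaxation in absolute-value form: `{u ∈ (−θ, θ)} = {|u| < θ}`. -/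
theorem setOf_mem_Ioo_eq_abs_lt {Ω : Type*} (u : Ω → ℝ) (θ : ℝ) :
    {x | u x ∈ Ioo (-θ) θ} = {x | |u x| < θ} := by
  ext x; simp only [mem_setOf_eq, mem_Ioo, abs_lt]

/-- **ODDS OF THE TWO OUTER SHELLS, abstractly**: from the two conditioned hazard bounds (upper shell vs `(−θ, θ′)`,
lower shell vs `(−θ′, θ)`, constant `c < 1`) for a finite measure:
`ν(({u ∈ (−θ′,θ′)} ∖ {u ∈ (−θ,θ)}) ∩ C) ≤ 2c∕(1−c) · ν({u ∈ (−θ,θ)} ∩ C)`. [textbook] -/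
theorem condOdds_letter_of_shellHazards {Ω : Type*} [MeasurableSpace Ω] (ν : Measure Ω) [IsFiniteMeasure ν]
    (u : Ω → ℝ) (C : Set Ω) {θ θ' c : ℝ} (hc0 : 0 ≤ c) (hc1 : c < 1)
    (hup : ν ({x | u x ∈ Ico θ θ'} ∩ C) ≤ ENNReal.ofReal c * ν ({x | u x ∈ Ioo (-θ) θ'} ∩ C))
    (hlow : ν ({x | u x ∈ Ioc (-θ') (-θ)} ∩ C) ≤ ENNReal.ofReal c * ν ({x | u x ∈ Ioo (-θ') θ} ∩ C)) :
    ν (({x | u x ∈ Ioo (-θ') θ'} \ {x | u x ∈ Ioo (-θ) θ}) ∩ C)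
      ≤ ENNReal.ofReal (2 * (c / (1 - c))) * ν ({x | u x ∈ Ioo (-θ) θ} ∩ C) := by
  obtain ⟨h0, h1, h2⟩ := letter_sets u θ θ'
  have hU := measure_le_odds_of_rel ν hc0 hc1 (S := {x | u x ∈ Ico θ θ'} ∩ C)
    (T := {x | u x ∈ Ioo (-θ) θ'} ∩ C) (P := {x | u x ∈ Ioo (-θ) θ} ∩ C)
    (fun x hx => (h1 hx.1).elim (fun h => Or.inl ⟨h, hx.2⟩) fun h => Or.inr ⟨h, hx.2⟩) hup
  have hL := measure_le_odds_of_rel ν hc0 hc1 (S := {x | u x ∈ Ioc (-θ') (-θ)} ∩ C)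
    (T := {x | u x ∈ Ioo (-θ') θ} ∩ C) (P := {x | u x ∈ Ioo (-θ) θ} ∩ C)
    (fun x hx => (h2 hx.1).elim (fun h => Or.inl ⟨h, hx.2⟩) fun h => Or.inr ⟨h, hx.2⟩) hlow
  have hsub : ({x | u x ∈ Ioo (-θ') θ'} \ {x | u x ∈ Ioo (-θ) θ}) ∩ C
      ⊆ ({x | u x ∈ Ico θ θ'} ∩ C) ∪ ({x | u x ∈ Ioc (-θ') (-θ)} ∩ C) := fun x hx =>
    (h0 hx.1).elim (fun h => Or.inl ⟨h, hx.2⟩) fun h => Or.inr ⟨h, hx.2⟩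
  have hc' : 0 ≤ c / (1 - c) := div_nonneg hc0 (by linarith)
  calc ν (({x | u x ∈ Ioo (-θ') θ'} \ {x | u x ∈ Ioo (-θ) θ}) ∩ C)
      ≤ ν (({x | u x ∈ Ico θ θ'} ∩ C) ∪ ({x | u x ∈ Ioc (-θ') (-θ)} ∩ C)) := measure_mono hsub
    _ ≤ ν ({x | u x ∈ Ico θ θ'} ∩ C) + ν ({x | u x ∈ Ioc (-θ') (-θ)} ∩ C) := measure_union_le _ _
    _ ≤ ENNReal.ofReal (c / (1 - c)) * ν ({x | u x ∈ Ioo (-θ) θ} ∩ C)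
        + ENNReal.ofReal (c / (1 - c)) * ν ({x | u x ∈ Ioo (-θ) θ} ∩ C) := add_le_add hU hL
    _ = ENNReal.ofReal (2 * (c / (1 - c))) * ν ({x | u x ∈ Ioo (-θ) θ} ∩ C) := by
        rw [← two_mul, ← mul_assoc, ENNReal.ofReal_mul zero_le_two, ENNReal.ofReal_ofNat]

section CoordOdds

variable {ι : Type*} [Fintype ι] [DecidableEq ι]

/-- **★ THE ADAPTER (lens ROW R), on `ℝ^ι`.**  `ν = e^{−A} dx` of finite mass; coordinate `p` carrying the KEPT
two-sided letter `{|x_p| < θ}` relaxed to `{|x_p| < θ′}`; inward one-sided slope `Λ > 0` of `A` along `x_p` on both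
outer shells (within `Λ⁻¹`, uniformly in the other coordinates), `Λ⁻¹ < 2θ`, `c := e·Λ·(θ′−θ) < 1`, `θ ≤ θ′`; `C`
measurable not reading `x_p`.  Then `ν(({x_p ∈ (−θ′,θ′)} ∖ {x_p ∈ (−θ,θ)}) ∩ C) ≤ 2c∕(1−c) · ν({x_p ∈ (−θ,θ)} ∩ C)`
— the outer shells `{θ ≤ |x_p| < θ′}` are carried by the letter itself (38i `condOdds_coord_of_partialSlope`,
mirrored and reflected). [textbook] -/
theorem condOdds_absCoord_of_partialSlopes {A : (ι → ℝ) → ℝ} (hA : Measurable A)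
    [IsFiniteMeasure (volume.withDensity fun x : ι → ℝ => ENNReal.ofReal (Real.exp (-A x)))]
    (p : ι) {θ θ' Λ : ℝ} (hΛ : 0 < Λ) (hwin : Λ⁻¹ < 2 * θ) (hθθ' : θ ≤ θ')
    (hc1 : Real.exp 1 * Λ * (θ' - θ) < 1)
    (hup : ∀ x : ι → ℝ, ∀ y₁ ∈ Ico θ θ', ∀ y₂ ∈ Icc (y₁ - Λ⁻¹) y₁,
      A (update x p y₂) - A (update x p y₁) ≤ Λ * (y₁ - y₂))
    (hlow : ∀ x : ι → ℝ, ∀ y₁ ∈ Ioc (-θ') (-θ), ∀ y₂ ∈ Icc y₁ (y₁ + Λ⁻¹),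
      A (update x p y₂) - A (update x p y₁) ≤ Λ * (y₂ - y₁))
    {C : Set (ι → ℝ)} (hC : MeasurableSet C) (hCp : ∀ x y, update x p y ∈ C ↔ x ∈ C) :
    (volume.withDensity fun x : ι → ℝ => ENNReal.ofReal (Real.exp (-A x)))
        (({x | x p ∈ Ioo (-θ') θ'} \ {x | x p ∈ Ioo (-θ) θ}) ∩ C)
      ≤ ENNReal.ofReal (2 * (Real.exp 1 * Λ * (θ' - θ) / (1 - Real.exp 1 * Λ * (θ' - θ)))) *
        (volume.withDensity fun x : ι → ℝ => ENNReal.ofReal (Real.exp (-A x))) ({x | x p ∈ Ioo (-θ) θ} ∩ C) := by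
  have hc0 : 0 ≤ Real.exp 1 * Λ * (θ' - θ) :=
    mul_nonneg (mul_nonneg (Real.exp_pos 1).le hΛ.le) (sub_nonneg.2 hθθ')
  exact condOdds_letter_of_shellHazards _ (fun x : ι → ℝ => x p) C hc0 hc1
    (measure_coordUpperShell_le_of_inwardSlope hA p hΛ hwin hup hC hCp)
    (measure_coordLowerShell_le_of_inwardSlope hA p hΛ hwin hlow hC hCp)

end CoordOdds

/-! ## §4 The same in the block frame `X × (κ → ℝ)` of parts 18∕27∕28 (38j §1 slicing) -/

section Block

variable {X : Type*} [MeasurableSpace X] (ζ : Measure X) {κ : Type*} [Fintype κ] [DecidableEq κ]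

/-- **★ THE ADAPTER IN P2's FRAME.**  `ν = (ζ ⊗ vol).withDensity e^{−A}` of finite mass on `X × (κ → ℝ)`; block
coordinate `i` carrying the kept letter `{|w_i| < θ}` relaxed to `{|w_i| < θ′}` (`θ ≤ θ′`); inward slopes on both
outer shells, `Λ⁻¹ < 2θ`, `c := e·Λ·(θ′−θ) < 1`; `C` measurable not reading `w_i`.  Then
`ν(({p.2 i ∈ (−θ′,θ′)} ∖ {p.2 i ∈ (−θ,θ)}) ∩ C) ≤ 2c∕(1−c) · ν({p.2 i ∈ (−θ,θ)} ∩ C)` — the per-letter `hodds`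
input of 38i §1 `measure_biInter_env_le_prod_of_condOdds` in the frame P2 consumes. [textbook] -/
theorem condOdds_absBlockCoord_of_partialSlopes {A : X × (κ → ℝ) → ℝ} (hA : Measurable A)
    [IsFiniteMeasure ((ζ.prod volume).withDensity fun p : X × (κ → ℝ) => ENNReal.ofReal (Real.exp (-A p)))]
    (i : κ) {θ θ' Λ : ℝ} (hΛ : 0 < Λ) (hwin : Λ⁻¹ < 2 * θ) (hθθ' : θ ≤ θ')
    (hc1 : Real.exp 1 * Λ * (θ' - θ) < 1)
    (hup : ∀ (z : X) (w : κ → ℝ), ∀ y₁ ∈ Ico θ θ', ∀ y₂ ∈ Icc (y₁ - Λ⁻¹) y₁,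
      A (z, update w i y₂) - A (z, update w i y₁) ≤ Λ * (y₁ - y₂))
    (hlow : ∀ (z : X) (w : κ → ℝ), ∀ y₁ ∈ Ioc (-θ') (-θ), ∀ y₂ ∈ Icc y₁ (y₁ + Λ⁻¹),
      A (z, update w i y₂) - A (z, update w i y₁) ≤ Λ * (y₂ - y₁))
    {C : Set (X × (κ → ℝ))} (hC : MeasurableSet C) (hCi : ∀ z w y, (z, update w i y) ∈ C ↔ (z, w) ∈ C) :
    ((ζ.prod volume).withDensity fun p : X × (κ → ℝ) => ENNReal.ofReal (Real.exp (-A p)))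
        (({p | p.2 i ∈ Ioo (-θ') θ'} \ {p | p.2 i ∈ Ioo (-θ) θ}) ∩ C)
      ≤ ENNReal.ofReal (2 * (Real.exp 1 * Λ * (θ' - θ) / (1 - Real.exp 1 * Λ * (θ' - θ)))) *
        ((ζ.prod volume).withDensity fun p : X × (κ → ℝ) => ENNReal.ofReal (Real.exp (-A p)))
          ({p | p.2 i ∈ Ioo (-θ) θ} ∩ C) := by
  have hc0 : 0 ≤ Real.exp 1 * Λ * (θ' - θ) :=
    mul_nonneg (mul_nonneg (Real.exp_pos 1).le hΛ.le) (sub_nonneg.2 hθθ')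
  have hg : Measurable fun p : X × (κ → ℝ) => ENNReal.ofReal (Real.exp (-A p)) :=
    ENNReal.measurable_ofReal.comp (Real.measurable_exp.comp hA.neg)
  have hu : Measurable fun p : X × (κ → ℝ) => p.2 i := (measurable_pi_apply i).comp measurable_snd
  have hAz : ∀ z : X, Measurable fun w : κ → ℝ => A (z, w) := fun z => hA.comp measurable_prodMk_left
  -- the two conditioned shell hazards of §3 on every exterior fibre, integrated by 38j §1
  refine condOdds_letter_of_shellHazards _ (fun p : X × (κ → ℝ) => p.2 i) C hc0 hc1 ?_ ?_
  · refine measure_le_mul_of_fibrewise ζ volume hg ((hu measurableSet_Ico).inter hC)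
      ((hu measurableSet_Ioo).inter hC) _ fun z => ?_
    exact measure_coordUpperShell_le_of_inwardSlope (hAz z) i hΛ hwin
      (fun w y₁ hy₁ y₂ hy₂ => hup z w y₁ hy₁ y₂ hy₂) (measurable_prodMk_left hC) (fun w y => hCi z w y)
  · refine measure_le_mul_of_fibrewise ζ volume hg ((hu measurableSet_Ioc).inter hC)
      ((hu measurableSet_Ioo).inter hC) _ fun z => ?_
    exact measure_coordLowerShell_le_of_inwardSlope (hAz z) i hΛ hwin
      (fun w y₁ hy₁ y₂ hy₂ => hlow z w y₁ hy₁ y₂ hy₂) (measurable_prodMk_left hC) (fun w y => hCi z w y)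

end Block

/-! ## §5 A6 witness: the binders of §4 are jointly inhabited (trivial exterior, Gaussian block weight) -/

section Witness

variable {κ : Type*} [Fintype κ] [DecidableEq κ]

open Summit.QuantumFields.YangMills.Theorems.N21CollarOddsBlockFrame (isFiniteMeasure_blockGaussianWeight)

/-- the Gaussian action's change under a coordinate update: `(y₂² − y₁²)∕2`. -/
theorem gaussianBlock_update_diff (i : κ) (w : κ → ℝ) (y₁ y₂ : ℝ) :
    (∑ j, update w i y₂ j ^ 2 / 2) - (∑ j, update w i y₁ j ^ 2 / 2) = (y₂ ^ 2 - y₁ ^ 2) / 2 := by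
  rw [← Finset.sum_sub_distrib, Finset.sum_eq_single i]
  · simp only [update_self]; ring
  · exact fun j _ hj => by rw [update_of_ne hj, update_of_ne hj, sub_self]
  · exact fun h => absurd (Finset.mem_univ i) h

/-- along the upper outer shell `[1, 7∕6)` of the letter `{|w_i| < 1}` the Gaussian action `Σ w²∕2` does not increase
going inward within `½` (slope hypothesis `hup`, `Λ = 2`); likewise along the lower outer shell `(−7∕6, −1]` going
inward to the right (`hlow`). [textbook] -/
theorem gaussianBlock_inwardSlopes (i : κ) :
    (∀ (_ : Unit) (w : κ → ℝ), ∀ y₁ ∈ Ico (1 : ℝ) (7 / 6), ∀ y₂ ∈ Icc (y₁ - (2 : ℝ)⁻¹) y₁,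
      (∑ j, update w i y₂ j ^ 2 / 2) - (∑ j, update w i y₁ j ^ 2 / 2) ≤ 2 * (y₁ - y₂)) ∧
    (∀ (_ : Unit) (w : κ → ℝ), ∀ y₁ ∈ Ioc (-(7 / 6) : ℝ) (-1), ∀ y₂ ∈ Icc y₁ (y₁ + (2 : ℝ)⁻¹),
      (∑ j, update w i y₂ j ^ 2 / 2) - (∑ j, update w i y₁ j ^ 2 / 2) ≤ 2 * (y₂ - y₁)) := by
  refine ⟨fun _ w y₁ hy₁ y₂ hy₂ => ?_, fun _ w y₁ hy₁ y₂ hy₂ => ?_⟩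
  · rw [gaussianBlock_update_diff]
    have h1 := hy₁.1; have h3 := hy₂.1; have h4 := hy₂.2
    nlinarith
  · rw [gaussianBlock_update_diff]
    have h2 := hy₁.2; have h3 := hy₂.1; have h4 := hy₂.2
    nlinarith

/-- **A6 WITNESS** (director-ym STANDING A6 RULE №189 (3)): §4's END `condOdds_absBlockCoord_of_partialSlopes`
APPLIED — exterior `X = Unit` under `dirac ()`, block `ℝ²` under the Gaussian weight, coordinate `0` carrying the
letter `{|w₀| < 1}` relaxed to `{|w₀| < 7∕6}`, `Λ = 2` (`Λ⁻¹ = ½ < 2`, `c = e∕3 < 1`), rest event `univ` — every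
binder discharged in the kernel; a satisfiability witness, not an estimate on Bałaban's measure. [textbook] -/
theorem collarLetterOdds_binders_inhabited :
    (((Measure.dirac ()).prod (volume : Measure (Fin 2 → ℝ))).withDensity
        fun p : Unit × (Fin 2 → ℝ) => ENNReal.ofReal (Real.exp (-(∑ i, p.2 i ^ 2 / 2))))
        (({p : Unit × (Fin 2 → ℝ) | p.2 0 ∈ Ioo (-(7 / 6) : ℝ) (7 / 6)} \ {p | p.2 0 ∈ Ioo (-1 : ℝ) 1}) ∩ univ)
      ≤ ENNReal.ofReal (2 * (Real.exp 1 * 2 * ((7 : ℝ) / 6 - 1) / (1 - Real.exp 1 * 2 * ((7 : ℝ) / 6 - 1)))) *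
        (((Measure.dirac ()).prod (volume : Measure (Fin 2 → ℝ))).withDensity
          fun p : Unit × (Fin 2 → ℝ) => ENNReal.ofReal (Real.exp (-(∑ i, p.2 i ^ 2 / 2))))
          ({p : Unit × (Fin 2 → ℝ) | p.2 0 ∈ Ioo (-1 : ℝ) 1} ∩ univ) := by
  haveI := isFiniteMeasure_blockGaussianWeight (κ := Fin 2)
  have hA : Measurable fun p : Unit × (Fin 2 → ℝ) => ∑ i, p.2 i ^ 2 / 2 :=
    Finset.measurable_sum _ fun i _ => (((measurable_pi_apply i).comp measurable_snd).pow_const 2).div_const 2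
  have he : Real.exp 1 * 2 * ((7 : ℝ) / 6 - 1) < 1 := by nlinarith [Real.exp_one_lt_d9]
  exact condOdds_absBlockCoord_of_partialSlopes (Measure.dirac ()) hA 0 (by norm_num) (by norm_num) (by norm_num)
    he (gaussianBlock_inwardSlopes 0).1 (gaussianBlock_inwardSlopes 0).2 MeasurableSet.univ
    (fun _ _ _ => by simp)

end Witness

end Summit.QuantumFields.YangMills.Theorems.N21CollarLetterOdds
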